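import Mathlib
import HarnessLib
import Literature.Probability.LatticeModels.WeightedRowSumResolvent
import Literature.MathematicalPhysics.QuantumLattice.HubbardGridCounterQuadraticMatrix
import Summits.HubbardSuperconductivity.HubbardSuperconductivity.Theorems.KLProgrammeKLRegimeEngineScaleZeroE4GridVertex
import Summits.HubbardSuperconductivity.HubbardSuperconductivity.Theorems.KLProgrammeKLRegimeEngineFramePosKernelMoment
import Literature.MathematicalPhysics.QuantumLattice.HubbardSpaceTimeCharacters

/-!
# K3 engine (gen-6 item `KLRegimeEngineV16`, stmt-HubbardSuperconductivity-20236), stub `stub_twoLeg_scale0` under the K-RESUMMED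
# representation (ρ2): the decay constants of the grid covariance DRESSED by the counterterm, from those of the bare grid covariance

Cell gate-hubbard-kl, seat p3 g8 ((ρ2)(iii)-DECAY).  In the K-resummed representation of the counterterm frame (k3c5-p1 g7, memo
`GLOBAL-MOMENTUM-SIZES-FINDING.md` §5 (ρ2); Literature `GrassmannGaussianQuadraticInsertion(TwoLeg)`) the quadratic counterterm
`𝒩_{K,N} = −q`, `q = Σ (−N_g)(X,Y) ψ(X)ψ(Y)` (`HubbardGridCounterQuadraticMatrix.neg_hubbardGridCounterQuadratic_eq_sum_sum`) is absorbed
into the grid covariance: `effAction G (V_N + 𝒩_{K,N})` is expressed through `effAction (M'·G) V_N` with `M'·(1 + G·S_g) = 1`,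
`S_g = of((−N_g)(X,Y) − (−N_g)(Y,X))`.  The decay-weighted single-scale step (`GrassmannWeightedEffectiveActionTruncationDB`, `…BiGradedDB`)
then reads the DRESSED covariance `M'·G` through its pair-weighted row / column sums for the tree weight `gridLabelWt L N β' = 1 + diam`
(positions `gridLegPos`), exactly as (E4)₀ reads `G` (`…ScaleZeroE4Assembly`, hypotheses `hrow`/`hcol ≤ α_w`).  This file supplies them
WITHOUT any symbol analysis of the dressed propagator (Literature `WeightedRowSumResolvent`: resolvent identity + fixed-point inequality):

* the pair weight `w(X,Y) = gridLabelWt L N β' {gridLegPos X, gridLegPos Y}` is `≥ 1`, submultiplicative, and on equal-time pairs equal to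
  the even profile `1 + |x⃗_X − x⃗_Y|_{ℓ^∞}` (`gridLabelWt_legPair_*`);
* **`rowSum_gridCounterAnti_mul_gridLabelWt_le` / `colSum_…`** — the counterterm matrix has weighted row and column sums
  `≤ ν_w := (|β|/N)·Σ_z ‖Ǩ_L(z)‖·(1 + |z|_{ℓ^∞})` — the SAME profile constant as (E4)₀'s `N_w(1)`
  (`sum_norm_kernel_hubbardGridCounterQuadratic_mul_wt_le`), ORDER ≤ 1 in position (safe side of (O2));
* **`rowSum_resummedGridCov_le` / `colSum_resummedGridCov_le`** — for ANY grid covariance `G` with `w`-weighted row and column sums `≤ α`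
  and ANY `M'` with `M'·(1 + G·S_g) = 1`: if `α·ν_w < 1` then the dressed covariance `M'·G` has `w`-weighted row and column sums
  `≤ α/(1 − α·ν_w)`; `isUnit_one_add_gridCov_mul_gridCounterAnti` / `resummedGridDressing_mul_eq_one` give the dressing `M' = (1 + G·S_g)⁻¹`;
  unweighted forms `…_unweighted` (plain `α`, `ν = (|β|/N)·Σ_z ‖Ǩ_L z‖`);
* **`sum_norm_framePosKernel_mul_weight_le_of_frameOK`** / `row(col)Sum_gridCounterAnti_mul_gridLabelWt_le_of_frameOK` — at an admissible frame
  `FrameOK R U Nsc μ K`: `ν_w ≤ (|β|/N)·(κ_R·|U| + 2(Nsc+1)U²·m_R)` with the `ℓ¹` constant `κ_R` of `…FramePosKernelPieces` and the first-moment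
  constant `m_R` of `…FramePosKernelMoment` (p494820) — explicit in `R.Gfr 0…3`.

At the engine's data (`G = Sᵀ C^K_{>e₀} S` on the `4M`-grid, `α = α_w` of (E4)₀, `Σ_z ‖Ǩ_L z‖(1 + |z|) ≤ κ_K + M₁ = O(Gfr·|U|)` by
`FramePosKernelL1` / p494820) the smallness `α_w·ν_w ≤ 1/2` is a `U ≤ U₀` condition and the dressed constant is `≤ 2α_w`.
Everything is proved; no definitions, no named facts, no sorry.  bears_on: `…Theses.KLProgramme.KLRegimeEngineV16` (stub `stub_twoLeg_scale0`,
(E3a)₀ `j ≤ 1` under (ρ2)); `--supports stmt-HubbardSuperconductivity-20236`.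
-/

noncomputable section

namespace Summit.HubbardSuperconductivity.HubbardSuperconductivity.Theorems.EngineV8

set_option linter.dupNamespace false -- summit = problem name (single-conjunct summit), D-0017

open Real Finset Literature.MathematicalPhysics.QuantumLattice Literature.Probability.LatticeModels
open Literature.Probability.LatticeModels.BattleFederbush

variable {L N : ℕ} [NeZero L] [NeZero N]

/-! ## §1 The pair weight of the scale-`0` decay bookkeeping on grid legs -/

omit [NeZero L] [NeZero N] in
/-- The leg-pair weight `gridLabelWt {pos X, pos Y}` is at least `1`. -/
theorem one_le_gridLabelWt_legPair (β' : ℝ) (X Y : GridLeg (GridPoint L N)) :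
    1 ≤ gridLabelWt L N β' {gridLegPos X, gridLegPos Y} :=
  one_le_gridLabelWt L N β' _

omit [NeZero L] [NeZero N] in
/-- The leg-pair weight is nonnegative. -/
theorem gridLabelWt_legPair_nonneg (β' : ℝ) (X Y : GridLeg (GridPoint L N)) :
    0 ≤ gridLabelWt L N β' {gridLegPos X, gridLegPos Y} :=
  zero_le_one.trans (one_le_gridLabelWt_legPair β' X Y)

/-- The leg-pair weight is submultiplicative: `w(X,Z) ≤ w(X,Y)·w(Y,Z)` (`gridLabelWt` is a tree weight, `β' ≥ 0`). -/
theorem gridLabelWt_legPair_submul {β' : ℝ} (hβ' : 0 ≤ β') (X Y Z : GridLeg (GridPoint L N)) :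
    gridLabelWt L N β' {gridLegPos X, gridLegPos Z} ≤
      gridLabelWt L N β' {gridLegPos X, gridLegPos Y} * gridLabelWt L N β' {gridLegPos Y, gridLegPos Z} :=
  (isTreeWeight_gridLabelWt L N hβ').pair_le_pair_mul_pair (gridLegPos X) (gridLegPos Y) (gridLegPos Z)

/-- On EQUAL-TIME pairs the leg-pair weight is the spatial profile `1 + |x⃗_X − x⃗_Y|_{ℓ^∞}`. -/
theorem gridLabelWt_legPair_of_sameTime {β' : ℝ} (hβ' : 0 ≤ β') (X Y : GridLeg (GridPoint L N)) (h : X.1.1.1 = Y.1.1.1) :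
    gridLabelWt L N β' {gridLegPos X, gridLegPos Y} = 1 + torusSiteDist (X.1.1.2 - Y.1.1.2) 0 := by
  obtain ⟨⟨⟨j, x⟩, σ⟩, c⟩ := X
  obtain ⟨⟨⟨j', y⟩, σ'⟩, c'⟩ := Y
  simp only at h
  subst h
  exact gridLabelWt_pair_sameTime hβ' j x y σ σ' c c'

/-- The spatial profile `1 + |z|_{ℓ^∞}` is nonnegative. -/
theorem one_add_torusSiteDist_nonneg (z : TorusSite 2 L) : 0 ≤ 1 + torusSiteDist z 0 :=
  add_nonneg zero_le_one (isLabelDist_torusSiteDist.nonneg _ _)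

/-- The spatial profile `1 + |z|_{ℓ^∞}` is even. -/
theorem one_add_torusSiteDist_neg (z : TorusSite 2 L) : 1 + torusSiteDist (-z) 0 = 1 + torusSiteDist z 0 := by
  rw [isLabelDist_torusSiteDist.symm (-z) 0, torusSiteDist_eq_sub_zero (0 : TorusSite 2 L) (-z), zero_sub, neg_neg]

/-! ## §2 The weighted row and column sums of the grid counterterm matrix (`ν_w`) -/

/-- **`ν_w` — weighted row sums of the counterterm matrix**: for every matrix `S` on grid legs dominated entrywise by the counterterm
matrix and its transpose (`‖S(X,Y)‖ ≤ ‖N_g(X,Y)‖ + ‖N_g(Y,X)‖`: `S_g = of(N_g − N_gᵀ)` and `of((−N_g) − (−N_g)ᵀ)`,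
`norm_gridCounterAnti_le` / `norm_neg_gridCounterAnti_le`), every `gridLabelWt`-pair-weighted row sum is
`≤ (|β|/N)·Σ_z ‖Ǩ_L(z)‖·(1 + |z|_{ℓ^∞})` (time-locality of `𝒩_{K,N}`; the profile of (E4)₀'s `N_w(1)`). -/
theorem rowSum_gridCounterAnti_mul_gridLabelWt_le (β : ℝ) {β' : ℝ} (hβ' : 0 ≤ β') (K : TrigPolyC4v)
    {S : Matrix (GridLeg (GridPoint L N)) (GridLeg (GridPoint L N)) ℂ}
    (hS : ∀ X Y, ‖S X Y‖ ≤ ‖gridCounterMatrix L N β K X Y‖ + ‖gridCounterMatrix L N β K Y X‖) (X : GridLeg (GridPoint L N)) :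
    ∑ Y, ‖S X Y‖ * gridLabelWt L N β' {gridLegPos X, gridLegPos Y} ≤
      |β| / N * ∑ z : TorusSite 2 L, ‖framePosKernel L K z‖ * (1 + torusSiteDist z 0) :=
  rowSum_le_of_norm_le_gridCounterMatrix (w := fun X Y => gridLabelWt L N β' {gridLegPos X, gridLegPos Y})
    (ω := fun z => 1 + torusSiteDist z 0) (gridLabelWt_legPair_nonneg β') one_add_torusSiteDist_nonneg one_add_torusSiteDist_neg
    (fun X Y h => (gridLabelWt_legPair_of_sameTime hβ' X Y h).le) β K hS X

/-- **`ν_w` — weighted column sums of the counterterm matrix** (same hypotheses): `≤ (|β|/N)·Σ_z ‖Ǩ_L(z)‖·(1 + |z|_{ℓ^∞})`. -/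
theorem colSum_gridCounterAnti_mul_gridLabelWt_le (β : ℝ) {β' : ℝ} (hβ' : 0 ≤ β') (K : TrigPolyC4v)
    {S : Matrix (GridLeg (GridPoint L N)) (GridLeg (GridPoint L N)) ℂ}
    (hS : ∀ X Y, ‖S X Y‖ ≤ ‖gridCounterMatrix L N β K X Y‖ + ‖gridCounterMatrix L N β K Y X‖) (Y : GridLeg (GridPoint L N)) :
    ∑ X, ‖S X Y‖ * gridLabelWt L N β' {gridLegPos X, gridLegPos Y} ≤
      |β| / N * ∑ z : TorusSite 2 L, ‖framePosKernel L K z‖ * (1 + torusSiteDist z 0) :=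
  colSum_le_of_norm_le_gridCounterMatrix (w := fun X Y => gridLabelWt L N β' {gridLegPos X, gridLegPos Y})
    (ω := fun z => 1 + torusSiteDist z 0) (gridLabelWt_legPair_nonneg β') one_add_torusSiteDist_nonneg one_add_torusSiteDist_neg
    (fun X Y h => (gridLabelWt_legPair_of_sameTime hβ' X Y h).le) β K hS Y

/-! ## §3 The dressed grid covariance `M'·G`, `M'·(1 + G·S_g) = 1` -/

section Resummed

variable {G M' S : Matrix (GridLeg (GridPoint L N)) (GridLeg (GridPoint L N)) ℂ} {β β' α ν : ℝ} {K : TrigPolyC4v}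

/-- **Weighted row sums of the dressed grid covariance**: if the grid covariance `G` has `gridLabelWt`-pair-weighted row sums `≤ α`,
`S` is dominated by the counterterm matrix (`‖S(X,Y)‖ ≤ ‖N_g(X,Y)‖ + ‖N_g(Y,X)‖`), `(|β|/N)·Σ_z ‖Ǩ_L z‖(1 + |z|) ≤ ν`, `α·ν < 1`, and
`M'·(1 + G·S) = 1`, then `M'·G` has weighted row sums `≤ α/(1 − α·ν)` (resolvent identity `M'G = G − (GS)(M'G)` and the fixed-point
inequality; `WeightedRowSumResolvent.rowSum_resolvent_mul_le`). -/
theorem rowSum_resummedGridCov_le (hβ' : 0 ≤ β') (hM : M' * (1 + G * S) = 1)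
    (hS : ∀ X Y, ‖S X Y‖ ≤ ‖gridCounterMatrix L N β K X Y‖ + ‖gridCounterMatrix L N β K Y X‖)
    (hG : ∀ X, ∑ Y, ‖G X Y‖ * gridLabelWt L N β' {gridLegPos X, gridLegPos Y} ≤ α)
    (hν : |β| / N * ∑ z : TorusSite 2 L, ‖framePosKernel L K z‖ * (1 + torusSiteDist z 0) ≤ ν) (hαν : α * ν < 1)
    (X : GridLeg (GridPoint L N)) :
    ∑ Y, ‖(M' * G) X Y‖ * gridLabelWt L N β' {gridLegPos X, gridLegPos Y} ≤ α / (1 - α * ν) :=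
  rowSum_resolvent_mul_le (fun X Y => gridLabelWt L N β' {gridLegPos X, gridLegPos Y}) (gridLabelWt_legPair_nonneg β')
    (gridLabelWt_legPair_submul hβ') hM hG (fun X => (rowSum_gridCounterAnti_mul_gridLabelWt_le β hβ' K hS X).trans hν) hαν X

/-- **Weighted column sums of the dressed grid covariance** (column hypotheses on `G`): `≤ α/(1 − α·ν)`. -/
theorem colSum_resummedGridCov_le (hβ' : 0 ≤ β') (hM : M' * (1 + G * S) = 1)
    (hS : ∀ X Y, ‖S X Y‖ ≤ ‖gridCounterMatrix L N β K X Y‖ + ‖gridCounterMatrix L N β K Y X‖)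
    (hG : ∀ Y, ∑ X, ‖G X Y‖ * gridLabelWt L N β' {gridLegPos X, gridLegPos Y} ≤ α)
    (hν : |β| / N * ∑ z : TorusSite 2 L, ‖framePosKernel L K z‖ * (1 + torusSiteDist z 0) ≤ ν) (hαν : α * ν < 1)
    (Y : GridLeg (GridPoint L N)) :
    ∑ X, ‖(M' * G) X Y‖ * gridLabelWt L N β' {gridLegPos X, gridLegPos Y} ≤ α / (1 - α * ν) :=
  colSum_resolvent_mul_le (fun X Y => gridLabelWt L N β' {gridLegPos X, gridLegPos Y}) (gridLabelWt_legPair_nonneg β')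
    (gridLabelWt_legPair_submul hβ') hM hG (fun Y => (colSum_gridCounterAnti_mul_gridLabelWt_le β hβ' K hS Y).trans hν) hαν Y

/-- **The dressing exists**: under the row hypotheses, `1 + G·S` is invertible (`α·ν < 1`; sup-norm kernel argument). -/
theorem isUnit_one_add_gridCov_mul_gridCounterAnti (hβ' : 0 ≤ β')
    (hS : ∀ X Y, ‖S X Y‖ ≤ ‖gridCounterMatrix L N β K X Y‖ + ‖gridCounterMatrix L N β K Y X‖)
    (hG : ∀ X, ∑ Y, ‖G X Y‖ * gridLabelWt L N β' {gridLegPos X, gridLegPos Y} ≤ α)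
    (hν : |β| / N * ∑ z : TorusSite 2 L, ‖framePosKernel L K z‖ * (1 + torusSiteDist z 0) ≤ ν) (hαν : α * ν < 1) :
    IsUnit (1 + G * S) :=
  isUnit_one_add_mul_of_rowSum_le (fun X Y => gridLabelWt L N β' {gridLegPos X, gridLegPos Y}) (one_le_gridLabelWt_legPair β')
    (gridLabelWt_legPair_submul hβ') hG (fun X => (rowSum_gridCounterAnti_mul_gridLabelWt_le β hβ' K hS X).trans hν) hαν

/-- **The canonical dressing `M' := (1 + G·S)⁻¹`** satisfies `M'·(1 + G·S) = 1` under the row hypotheses. -/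
theorem resummedGridDressing_mul_eq_one (hβ' : 0 ≤ β')
    (hS : ∀ X Y, ‖S X Y‖ ≤ ‖gridCounterMatrix L N β K X Y‖ + ‖gridCounterMatrix L N β K Y X‖)
    (hG : ∀ X, ∑ Y, ‖G X Y‖ * gridLabelWt L N β' {gridLegPos X, gridLegPos Y} ≤ α)
    (hν : |β| / N * ∑ z : TorusSite 2 L, ‖framePosKernel L K z‖ * (1 + torusSiteDist z 0) ≤ ν) (hαν : α * ν < 1) :
    (1 + G * S)⁻¹ * (1 + G * S) = 1 :=
  inv_one_add_mul_mul_eq_one (fun X Y => gridLabelWt L N β' {gridLegPos X, gridLegPos Y}) (one_le_gridLabelWt_legPair β')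
    (gridLabelWt_legPair_submul hβ') hG (fun X => (rowSum_gridCounterAnti_mul_gridLabelWt_le β hβ' K hS X).trans hν) hαν

/-- **Field dressing `M' − 1`**: weighted row sums `≤ α·ν/(1 − α·ν)` (the substitution `T = 1 + …` of the K-resummed representation is
close to the identity in the decay norm). -/
theorem rowSum_resummedGridDressing_sub_one_le (hβ' : 0 ≤ β') (hM : M' * (1 + G * S) = 1)
    (hS : ∀ X Y, ‖S X Y‖ ≤ ‖gridCounterMatrix L N β K X Y‖ + ‖gridCounterMatrix L N β K Y X‖)
    (hG : ∀ X, ∑ Y, ‖G X Y‖ * gridLabelWt L N β' {gridLegPos X, gridLegPos Y} ≤ α)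
    (hν : |β| / N * ∑ z : TorusSite 2 L, ‖framePosKernel L K z‖ * (1 + torusSiteDist z 0) ≤ ν) (hαν : α * ν < 1)
    (X : GridLeg (GridPoint L N)) :
    ∑ Y, ‖(M' - 1) X Y‖ * gridLabelWt L N β' {gridLegPos X, gridLegPos Y} ≤ α * ν / (1 - α * ν) :=
  rowSum_resolvent_sub_one_le (fun X Y => gridLabelWt L N β' {gridLegPos X, gridLegPos Y}) (gridLabelWt_legPair_nonneg β')
    (gridLabelWt_legPair_submul hβ') hM hG (fun X => (rowSum_gridCounterAnti_mul_gridLabelWt_le β hβ' K hS X).trans hν) hαν X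

/-- **Half smallness gives a factor two**: if `α·ν ≤ 1/2` (a `U ≤ U₀` condition at the engine's data) then the dressed weighted row sums
are `≤ 2α`. -/
theorem rowSum_resummedGridCov_le_two_mul (hβ' : 0 ≤ β') (hM : M' * (1 + G * S) = 1)
    (hS : ∀ X Y, ‖S X Y‖ ≤ ‖gridCounterMatrix L N β K X Y‖ + ‖gridCounterMatrix L N β K Y X‖)
    (hG : ∀ X, ∑ Y, ‖G X Y‖ * gridLabelWt L N β' {gridLegPos X, gridLegPos Y} ≤ α)
    (hν : |β| / N * ∑ z : TorusSite 2 L, ‖framePosKernel L K z‖ * (1 + torusSiteDist z 0) ≤ ν) (hα : 0 ≤ α) (hαν : α * ν ≤ 1 / 2)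
    (X : GridLeg (GridPoint L N)) :
    ∑ Y, ‖(M' * G) X Y‖ * gridLabelWt L N β' {gridLegPos X, gridLegPos Y} ≤ 2 * α := by
  have h := rowSum_resummedGridCov_le hβ' hM hS hG hν (by linarith) X
  refine h.trans ?_
  rw [div_le_iff₀ (by linarith)]
  nlinarith

/-- Column twin of `rowSum_resummedGridCov_le_two_mul`. -/
theorem colSum_resummedGridCov_le_two_mul (hβ' : 0 ≤ β') (hM : M' * (1 + G * S) = 1)
    (hS : ∀ X Y, ‖S X Y‖ ≤ ‖gridCounterMatrix L N β K X Y‖ + ‖gridCounterMatrix L N β K Y X‖)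
    (hG : ∀ Y, ∑ X, ‖G X Y‖ * gridLabelWt L N β' {gridLegPos X, gridLegPos Y} ≤ α)
    (hν : |β| / N * ∑ z : TorusSite 2 L, ‖framePosKernel L K z‖ * (1 + torusSiteDist z 0) ≤ ν) (hα : 0 ≤ α) (hαν : α * ν ≤ 1 / 2)
    (Y : GridLeg (GridPoint L N)) :
    ∑ X, ‖(M' * G) X Y‖ * gridLabelWt L N β' {gridLegPos X, gridLegPos Y} ≤ 2 * α := by
  have h := colSum_resummedGridCov_le hβ' hM hS hG hν (by linarith) Y
  refine h.trans ?_
  rw [div_le_iff₀ (by linarith)]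
  nlinarith

omit [NeZero N] in
/-- **Unweighted row sums of the dressed grid covariance** (the plain `α` of (E1-v4)₀-type steps): `M'·(1 + G·S) = 1`,
`Σ_Y ‖G(X,Y)‖ ≤ α`, `(|β|/N)·Σ_z ‖Ǩ_L z‖ ≤ ν`, `α·ν < 1 ⇒ Σ_Y ‖(M'·G)(X,Y)‖ ≤ α/(1 − α·ν)`. -/
theorem rowSum_resummedGridCov_le_unweighted (hM : M' * (1 + G * S) = 1)
    (hS : ∀ X Y, ‖S X Y‖ ≤ ‖gridCounterMatrix L N β K X Y‖ + ‖gridCounterMatrix L N β K Y X‖)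
    (hG : ∀ X, ∑ Y, ‖G X Y‖ ≤ α) (hν : |β| / N * ∑ z : TorusSite 2 L, ‖framePosKernel L K z‖ ≤ ν) (hαν : α * ν < 1)
    (X : GridLeg (GridPoint L N)) : ∑ Y, ‖(M' * G) X Y‖ ≤ α / (1 - α * ν) :=
  rowSum_resolvent_mul_le_unweighted hM hG (fun X => (rowSum_le_of_norm_le_gridCounterMatrix_unweighted β K hS X).trans hν) hαν X

omit [NeZero N] in
/-- **Unweighted column sums of the dressed grid covariance**: `Σ_X ‖(M'·G)(X,Y)‖ ≤ α/(1 − α·ν)`. -/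
theorem colSum_resummedGridCov_le_unweighted (hM : M' * (1 + G * S) = 1)
    (hS : ∀ X Y, ‖S X Y‖ ≤ ‖gridCounterMatrix L N β K X Y‖ + ‖gridCounterMatrix L N β K Y X‖)
    (hG : ∀ Y, ∑ X, ‖G X Y‖ ≤ α) (hν : |β| / N * ∑ z : TorusSite 2 L, ‖framePosKernel L K z‖ ≤ ν) (hαν : α * ν < 1)
    (Y : GridLeg (GridPoint L N)) : ∑ X, ‖(M' * G) X Y‖ ≤ α / (1 - α * ν) :=
  colSum_resolvent_mul_le_unweighted hM hG (fun Y => (colSum_le_of_norm_le_gridCounterMatrix_unweighted β K hS Y).trans hν) hαν Y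

omit [NeZero N] in
/-- **Unweighted invertibility**: `Σ_Y ‖G(X,Y)‖ ≤ α`, `(|β|/N)·Σ_z ‖Ǩ_L z‖ ≤ ν`, `α·ν < 1 ⇒ 1 + G·S` invertible. -/
theorem isUnit_one_add_gridCov_mul_gridCounterAnti_unweighted
    (hS : ∀ X Y, ‖S X Y‖ ≤ ‖gridCounterMatrix L N β K X Y‖ + ‖gridCounterMatrix L N β K Y X‖)
    (hG : ∀ X, ∑ Y, ‖G X Y‖ ≤ α) (hν : |β| / N * ∑ z : TorusSite 2 L, ‖framePosKernel L K z‖ ≤ ν) (hαν : α * ν < 1) :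
    IsUnit (1 + G * S) :=
  isUnit_one_add_mul_unweighted hG (fun X => (rowSum_le_of_norm_le_gridCounterMatrix_unweighted β K hS X).trans hν) hαν

end Resummed

/-! ## §4 `ν_w` at the admissible frames: an `O(|U|) + O((N_sc+1)U²)` constant of the package `R` alone -/

section Frames

open Summit.HubbardSuperconductivity.HubbardSuperconductivity.Theorems.KLRegimeSplit

/-- **The weighted `ℓ¹` size of an admissible frame's position kernel**: for `FrameOK R U Nsc μ K` (`R.WF`, `0 < |U| ≤ 1`),
`Σ_z ‖Ǩ_L(z)‖·(1 + |z|_{ℓ^∞}) ≤ κ_R·|U| + 2·(Nsc+1)·U²·m_R` with the `ℓ¹` constant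
`κ_R = 256·((4/3)√(24π²(Gfr0+1)(Gfr2+1)) + (128/15)(Gfr0+1))` (`sum_norm_framePosKernel_le_linear_of_frameOK`) and the first-moment constant
`m_R = 6·(π·Gfr1/2 + π²·Gfr2/(2√2) + π³·Gfr3/8)` (`sum_abs_mul_norm_framePosKernel_le_of_frameOK`, both directions; `|z|_{ℓ^∞} ≤ |z̃₁| + |z̃₂|`).
FIRST position moment only — the safe side of (O2). -/
theorem sum_norm_framePosKernel_mul_weight_le_of_frameOK {R : RenConsts} (hR : R.WF) {U : ℝ} (hU : U ≠ 0) (hU1 : |U| ≤ 1)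
    {Nsc : ℕ} {μ : ℝ} {K : TrigPolyC4v} (hK : FrameOK R U Nsc μ K) :
    ∑ z : TorusSite 2 L, ‖framePosKernel L K z‖ * (1 + torusSiteDist z 0) ≤
      256 * ((4 / 3) * Real.sqrt (24 * π ^ 2 * (R.Gfr 0 + 1) * (R.Gfr 2 + 1)) + (128 / 15) * (R.Gfr 0 + 1)) * |U| +
        2 * (((Nsc : ℝ) + 1) * U ^ 2 * (6 * (Real.pi * R.Gfr 1 / 2 + Real.pi ^ 2 * R.Gfr 2 / (2 * Real.sqrt 2) + Real.pi ^ 3 * R.Gfr 3 / 8))) := by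
  have hG : ∀ j, 0 ≤ R.Gfr j := hR.2.2
  have h0 := sum_norm_framePosKernel_le_linear_of_frameOK (L := L) hR hU hU1 hK
  have h1 := sum_abs_mul_norm_framePosKernel_le_of_frameOK (L := L) hG hK 0
  have h2 := sum_abs_mul_norm_framePosKernel_le_of_frameOK (L := L) hG hK 1
  -- `|z|_{ℓ^∞} ≤ |z̃₁| + |z̃₂|`
  have hdist : ∀ z : TorusSite 2 L, torusSiteDist z 0 ≤ |((z 0).valMinAbs : ℝ)| + |((z 1).valMinAbs : ℝ)| := by
    intro z
    have h := torusSiteDist_le_abs_add_abs z 0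
    rwa [sub_zero] at h
  calc ∑ z : TorusSite 2 L, ‖framePosKernel L K z‖ * (1 + torusSiteDist z 0)
      ≤ ∑ z : TorusSite 2 L, (‖framePosKernel L K z‖ + (|((z 0).valMinAbs : ℝ)| * ‖framePosKernel L K z‖ +
          |((z 1).valMinAbs : ℝ)| * ‖framePosKernel L K z‖)) := by
        refine sum_le_sum fun z _ => ?_
        have hn := norm_nonneg (framePosKernel L K z)
        nlinarith [hdist z, hn]
    _ = ∑ z : TorusSite 2 L, ‖framePosKernel L K z‖ + (∑ z : TorusSite 2 L, |((z 0).valMinAbs : ℝ)| * ‖framePosKernel L K z‖ +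
          ∑ z : TorusSite 2 L, |((z 1).valMinAbs : ℝ)| * ‖framePosKernel L K z‖) := by
        rw [sum_add_distrib, sum_add_distrib]
    _ ≤ _ := by
        refine add_le_add h0 ?_
        rw [two_mul]
        exact add_le_add h1 h2

/-- **`ν_w` at an admissible frame**: the weighted row/column bound of the counterterm matrix (any `S` dominated by `N_g`, `N_gᵀ`) is
`≤ (|β|/N)·(κ_R·|U| + 2·(Nsc+1)·U²·m_R)` for `FrameOK R U Nsc μ K`, `R.WF`, `0 < |U| ≤ 1` — `O(|U|)` (the `(Nsc+1)·U²` factor is `O(c + U²)` in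
the KL regime), so the smallness `α_w·ν_w ≤ 1/2` of `rowSum_resummedGridCov_le_two_mul` is a `U ≤ U₀` condition once `α_w = O(N/|β|)`. -/
theorem rowSum_gridCounterAnti_mul_gridLabelWt_le_of_frameOK {R : RenConsts} (hR : R.WF) {U : ℝ} (hU : U ≠ 0) (hU1 : |U| ≤ 1)
    {Nsc : ℕ} {μ : ℝ} {K : TrigPolyC4v} (hK : FrameOK R U Nsc μ K) (β : ℝ) {β' : ℝ} (hβ' : 0 ≤ β')
    {S : Matrix (GridLeg (GridPoint L N)) (GridLeg (GridPoint L N)) ℂ}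
    (hS : ∀ X Y, ‖S X Y‖ ≤ ‖gridCounterMatrix L N β K X Y‖ + ‖gridCounterMatrix L N β K Y X‖) (X : GridLeg (GridPoint L N)) :
    ∑ Y, ‖S X Y‖ * gridLabelWt L N β' {gridLegPos X, gridLegPos Y} ≤
      |β| / N * (256 * ((4 / 3) * Real.sqrt (24 * π ^ 2 * (R.Gfr 0 + 1) * (R.Gfr 2 + 1)) + (128 / 15) * (R.Gfr 0 + 1)) * |U| +
        2 * (((Nsc : ℝ) + 1) * U ^ 2 * (6 * (Real.pi * R.Gfr 1 / 2 + Real.pi ^ 2 * R.Gfr 2 / (2 * Real.sqrt 2) + Real.pi ^ 3 * R.Gfr 3 / 8)))) :=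
  (rowSum_gridCounterAnti_mul_gridLabelWt_le β hβ' K hS X).trans
    (mul_le_mul_of_nonneg_left (sum_norm_framePosKernel_mul_weight_le_of_frameOK hR hU hU1 hK) (by positivity))

/-- Column twin of `rowSum_gridCounterAnti_mul_gridLabelWt_le_of_frameOK`. -/
theorem colSum_gridCounterAnti_mul_gridLabelWt_le_of_frameOK {R : RenConsts} (hR : R.WF) {U : ℝ} (hU : U ≠ 0) (hU1 : |U| ≤ 1)
    {Nsc : ℕ} {μ : ℝ} {K : TrigPolyC4v} (hK : FrameOK R U Nsc μ K) (β : ℝ) {β' : ℝ} (hβ' : 0 ≤ β')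
    {S : Matrix (GridLeg (GridPoint L N)) (GridLeg (GridPoint L N)) ℂ}
    (hS : ∀ X Y, ‖S X Y‖ ≤ ‖gridCounterMatrix L N β K X Y‖ + ‖gridCounterMatrix L N β K Y X‖) (Y : GridLeg (GridPoint L N)) :
    ∑ X, ‖S X Y‖ * gridLabelWt L N β' {gridLegPos X, gridLegPos Y} ≤
      |β| / N * (256 * ((4 / 3) * Real.sqrt (24 * π ^ 2 * (R.Gfr 0 + 1) * (R.Gfr 2 + 1)) + (128 / 15) * (R.Gfr 0 + 1)) * |U| +
        2 * (((Nsc : ℝ) + 1) * U ^ 2 * (6 * (Real.pi * R.Gfr 1 / 2 + Real.pi ^ 2 * R.Gfr 2 / (2 * Real.sqrt 2) + Real.pi ^ 3 * R.Gfr 3 / 8)))) :=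
  (colSum_gridCounterAnti_mul_gridLabelWt_le β hβ' K hS Y).trans
    (mul_le_mul_of_nonneg_left (sum_norm_framePosKernel_mul_weight_le_of_frameOK hR hU hU1 hK) (by positivity))

end Frames

end Summit.HubbardSuperconductivity.HubbardSuperconductivity.Theorems.EngineV8

end
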